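import Mathlib
import Summits.PneNP.PneNP.Theorems.OverlapGapAlgebraSolvableImpliesStableSectionUnitClauseFirstMoment
import Summits.PneNP.PneNP.Theorems.OverlapGapAlgebraSolvableImpliesStableSectionUnitClausePairSums

/-!
# PneNP / OverlapGapAlgebra — crux `SolvableImpliesStableSection` (stmt-PneNP-2463):
# the UNIT CLAUSE block (12/·) — second moment of the number of unit clauses; contradiction pairs

Support for crux `stmt-PneNP-2463` (`Summit.PneNP.PneNP.Theses.OverlapGapAlgebra.SolvableImpliesStableSection`),
registered stub `stub_lowDensity` (child G).  With `N^S_t` the number of non-muted unit clauses at round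
`t`, `W` a bound on the label windows, `a` the first-moment level (`Σ_Φ N^S_t ≤ a·#Ω`,
`sissU_sum_unit_le`) and `K = (k²-k)·2M·n^{k-1}` the first-moment constant:
* SECOND MOMENT: `Σ_Φ (N^S_{t+1})² ≤ a·#Ω + m²(K/#C)²·(W² + 2Wa + q)·#Ω` whenever `Σ_Φ (N^{S'}_t)² ≤ q·#Ω`
  for all `S'` — the square `(W + N)²` is expanded exactly, so the coefficient of `q` is `β² < 1` with
  `β = mK/#C` the first-moment contraction: the recursion closes up to the unit-clause threshold
  (`sissU_sum_unit_sq_le`, by induction from a fixed-point hypothesis);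
* CONTRADICTION PAIRS: the ordered pairs of distinct clauses unit on the same variable at round `t + 1`
  have `Σ_Φ #pairs ≤ m²·(K·K₂/#C²)·(W² + 2Wa + q)·#Ω`, `K₂ = k(k²-k)·2·n^{k-2}` — an extra factor `1/n`
  (`sissU_sum_cpairs_le`).

All objects are hypotheses; no definitions; axioms `propext`, `Classical.choice`, `Quot.sound`.
-/

set_option linter.dupNamespace false -- `Summit.PneNP.PneNP.…`: summit = sub-problem (D-0017)

namespace Summit.PneNP.PneNP.Theorems

open Finset
open scoped Classical

section SecondMoment

variable {m k n : ℕ} {R : ℕ}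
  (st : Finset (Fin m) → ℕ → (Fin m → Fin k → Fin n × Bool) → Fin n → Option Bool)
  (dm : Finset (Fin m) → ℕ → (Fin m → Fin k → Fin n × Bool) → Fin n → Bool)
  (h0 : ∀ (S : Finset (Fin m)) (Φ : Fin m → Fin k → Fin n × Bool) (v : Fin n), st S 0 Φ v = none)
  (hstep : ∀ (S : Finset (Fin m)) (t : ℕ) (Φ : Fin m → Fin k → Fin n × Bool) (v : Fin n),
    st S (t + 1) Φ v =
      if st S t Φ v = none then
        (if ∃ i : Fin m, i ∉ S ∧ ∃ j : Fin k, (Φ i j).1 = v ∧ ∀ j' : Fin k, j' ≠ j →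
            st S t Φ (Φ i j').1 ≠ none ∧ st S t Φ (Φ i j').1 ≠ some (Φ i j').2
          then some (dm S t Φ v)
          else if (v : ℕ) * R / n = t then some true else none)
      else st S t Φ v)
  (hdm : ∀ (S : Finset (Fin m)) (t : ℕ) (Φ : Fin m → Fin k → Fin n × Bool) (v : Fin n) (i : Fin m)
    (j : Fin k), i ∉ S → (Φ i j).1 = v → st S t Φ v = none →
    (∀ j' : Fin k, j' ≠ j → st S t Φ (Φ i j').1 ≠ none ∧ st S t Φ (Φ i j').1 ≠ some (Φ i j').2) →
    (∀ i' : Fin m, i' ∉ S → (∃ j₁ : Fin k, (Φ i' j₁).1 = v ∧ ∀ j' : Fin k, j' ≠ j₁ →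
      st S t Φ (Φ i' j').1 ≠ none ∧ st S t Φ (Φ i' j').1 ≠ some (Φ i' j').2) → i ≤ i') →
    dm S t Φ v = (Φ i j).2)
  (M : ℝ) (hM : ∀ u s : ℕ, u + s = n → (u : ℝ) * (s : ℝ) ^ (k - 2) ≤ M * (n : ℝ) ^ (k - 1))
  (W : ℝ) (hW : ∀ t : ℕ, ((((univ : Finset (Fin n)).filter fun v : Fin n => (v : ℕ) * R / n = t).card : ℕ) : ℝ) ≤ W)
  (a : ℝ) (ha : 0 ≤ a)
  (hN : ∀ (t : ℕ) (S : Finset (Fin m)), ∑ Φ : Fin m → Fin k → Fin n × Bool,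
    (((univ : Finset (Fin m)).filter fun i => i ∉ S ∧ ∃ j : Fin k, st S t Φ (Φ i j).1 = none ∧
      ∀ j' : Fin k, j' ≠ j → st S t Φ (Φ i j').1 ≠ none ∧ st S t Φ (Φ i j').1 ≠ some (Φ i j').2).card : ℝ)
    ≤ a * Fintype.card (Fin m → Fin k → Fin n × Bool))

include hstep hW hN in
/-- **The expanded square of the new variables.** If `Σ_Φ (N^{S'}_t)² ≤ q·#Ω`, then
`Σ_Φ New^{S'}_t(Φ)² ≤ (W² + 2Wa + q)·#Ω` (with `New ≤ W_t + N`, `sissU_card_new_le`). -/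
theorem sissU_sum_new_sq_le (q : ℝ) (t : ℕ) (S' : Finset (Fin m))
    (hq : ∑ Φ : Fin m → Fin k → Fin n × Bool,
      (((univ : Finset (Fin m)).filter fun i => i ∉ S' ∧ ∃ j : Fin k, st S' t Φ (Φ i j).1 = none ∧
        ∀ j' : Fin k, j' ≠ j → st S' t Φ (Φ i j').1 ≠ none ∧ st S' t Φ (Φ i j').1 ≠ some (Φ i j').2).card : ℝ) ^ 2
      ≤ q * Fintype.card (Fin m → Fin k → Fin n × Bool)) :
    ∑ Φ : Fin m → Fin k → Fin n × Bool,
      ((((univ : Finset (Fin n)).filter fun w => st S' t Φ w = none ∧ st S' (t + 1) Φ w ≠ none).card : ℕ) : ℝ) ^ 2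
      ≤ (W ^ 2 + 2 * W * a + q) * Fintype.card (Fin m → Fin k → Fin n × Bool) := by
  have hW0 : 0 ≤ W := le_trans (Nat.cast_nonneg _) (hW 0)
  have hpt : ∀ Φ : Fin m → Fin k → Fin n × Bool,
      ((((univ : Finset (Fin n)).filter fun w => st S' t Φ w = none ∧ st S' (t + 1) Φ w ≠ none).card : ℕ) : ℝ) ^ 2
        ≤ W ^ 2 + 2 * W * (((univ : Finset (Fin m)).filter fun i => i ∉ S' ∧ ∃ j : Fin k,
            st S' t Φ (Φ i j).1 = none ∧ ∀ j' : Fin k, j' ≠ j →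
              st S' t Φ (Φ i j').1 ≠ none ∧ st S' t Φ (Φ i j').1 ≠ some (Φ i j').2).card : ℝ) +
          (((univ : Finset (Fin m)).filter fun i => i ∉ S' ∧ ∃ j : Fin k,
            st S' t Φ (Φ i j).1 = none ∧ ∀ j' : Fin k, j' ≠ j →
              st S' t Φ (Φ i j').1 ≠ none ∧ st S' t Φ (Φ i j').1 ≠ some (Φ i j').2).card : ℝ) ^ 2 := by
    intro Φ
    have h1 := sissU_card_new_le st dm hstep S' t Φ
    have h2 : ((((univ : Finset (Fin n)).filter fun w => st S' t Φ w = none ∧ st S' (t + 1) Φ w ≠ none).card : ℕ) : ℝ)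
        ≤ W + (((univ : Finset (Fin m)).filter fun i => i ∉ S' ∧ ∃ j : Fin k,
            st S' t Φ (Φ i j).1 = none ∧ ∀ j' : Fin k, j' ≠ j →
              st S' t Φ (Φ i j').1 ≠ none ∧ st S' t Φ (Φ i j').1 ≠ some (Φ i j').2).card : ℝ) := by
      have h1' : ((((univ : Finset (Fin n)).filter fun w => st S' t Φ w = none ∧ st S' (t + 1) Φ w ≠ none).card : ℕ) : ℝ)
          ≤ ((((univ : Finset (Fin n)).filter fun v : Fin n => (v : ℕ) * R / n = t).card : ℕ) : ℝ) +
            (((univ : Finset (Fin m)).filter fun i => i ∉ S' ∧ ∃ j : Fin k,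
              st S' t Φ (Φ i j).1 = none ∧ ∀ j' : Fin k, j' ≠ j →
                st S' t Φ (Φ i j').1 ≠ none ∧ st S' t Φ (Φ i j').1 ≠ some (Φ i j').2).card : ℝ) := by
        exact_mod_cast h1
      exact h1'.trans (add_le_add (hW t) le_rfl)
    have h3 := pow_le_pow_left₀ (Nat.cast_nonneg _) h2 2
    refine h3.trans (le_of_eq ?_)
    ring
  refine (sum_le_sum fun Φ _ => hpt Φ).trans ?_
  rw [sum_add_distrib, sum_add_distrib, sum_const, card_univ, nsmul_eq_mul, ← mul_sum]
  have h4 := hN t S'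
  nlinarith [h4, hq, hW0]

include h0 hstep hdm hM hW hN in
/-- **Second-moment step.** If `Σ_Φ (N^{S'}_t)² ≤ q·#Ω` for every muted set `S'`, then for every `S`:
`#C²·Σ_Φ (N^S_{t+1})² ≤ #C²·a·#Ω + m²·K²·(W² + 2Wa + q)·#Ω`, `K = (k²-k)·2M·n^{k-1}`. -/
theorem sissU_sum_unit_sq_succ_le (q : ℝ) (t : ℕ)
    (hq : ∀ S' : Finset (Fin m), ∑ Φ : Fin m → Fin k → Fin n × Bool,
      (((univ : Finset (Fin m)).filter fun i => i ∉ S' ∧ ∃ j : Fin k, st S' t Φ (Φ i j).1 = none ∧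
        ∀ j' : Fin k, j' ≠ j → st S' t Φ (Φ i j').1 ≠ none ∧ st S' t Φ (Φ i j').1 ≠ some (Φ i j').2).card : ℝ) ^ 2
      ≤ q * Fintype.card (Fin m → Fin k → Fin n × Bool))
    (S : Finset (Fin m)) :
    (Fintype.card (Fin k → Fin n × Bool) : ℝ) ^ 2 * ∑ Φ : Fin m → Fin k → Fin n × Bool,
      (((univ : Finset (Fin m)).filter fun i => i ∉ S ∧ ∃ j : Fin k, st S (t + 1) Φ (Φ i j).1 = none ∧
        ∀ j' : Fin k, j' ≠ j → st S (t + 1) Φ (Φ i j').1 ≠ none ∧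
          st S (t + 1) Φ (Φ i j').1 ≠ some (Φ i j').2).card : ℝ) ^ 2
      ≤ (Fintype.card (Fin k → Fin n × Bool) : ℝ) ^ 2 * (a * Fintype.card (Fin m → Fin k → Fin n × Bool)) +
        ((m : ℝ) * m) * (((k * k - k : ℕ) : ℝ) * (2 * M * (n : ℝ) ^ (k - 1))) ^ 2 *
          ((W ^ 2 + 2 * W * a + q) * Fintype.card (Fin m → Fin k → Fin n × Bool)) := by
  -- `card² = card + #offDiag`
  have hsq : ∀ Φ : Fin m → Fin k → Fin n × Bool,
      (((univ : Finset (Fin m)).filter fun i => i ∉ S ∧ ∃ j : Fin k, st S (t + 1) Φ (Φ i j).1 = none ∧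
        ∀ j' : Fin k, j' ≠ j → st S (t + 1) Φ (Φ i j').1 ≠ none ∧
          st S (t + 1) Φ (Φ i j').1 ≠ some (Φ i j').2).card : ℝ) ^ 2
        = (((univ : Finset (Fin m)).filter fun i => i ∉ S ∧ ∃ j : Fin k, st S (t + 1) Φ (Φ i j).1 = none ∧
            ∀ j' : Fin k, j' ≠ j → st S (t + 1) Φ (Φ i j').1 ≠ none ∧
              st S (t + 1) Φ (Φ i j').1 ≠ some (Φ i j').2).card : ℝ) +
          ∑ p ∈ (univ : Finset (Fin m)).offDiag,
            (if ((p.1 ∉ S ∧ p.2 ∉ S) ∧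
                ((∃ j : Fin k, st S (t + 1) Φ (Φ p.1 j).1 = none ∧ ∀ j' : Fin k, j' ≠ j →
                  st S (t + 1) Φ (Φ p.1 j').1 ≠ none ∧ st S (t + 1) Φ (Φ p.1 j').1 ≠ some (Φ p.1 j').2) ∧
                (∃ j : Fin k, st S (t + 1) Φ (Φ p.2 j).1 = none ∧ ∀ j' : Fin k, j' ≠ j →
                  st S (t + 1) Φ (Φ p.2 j').1 ≠ none ∧ st S (t + 1) Φ (Φ p.2 j').1 ≠ some (Φ p.2 j').2)))
              then (1 : ℝ) else 0) := by
    intro Φ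
    set F := (univ : Finset (Fin m)).filter fun i => i ∉ S ∧ ∃ j : Fin k, st S (t + 1) Φ (Φ i j).1 = none ∧
        ∀ j' : Fin k, j' ≠ j → st S (t + 1) Φ (Φ i j').1 ≠ none ∧
          st S (t + 1) Φ (Φ i j').1 ≠ some (Φ i j').2 with hF
    have hoff : (∑ p ∈ (univ : Finset (Fin m)).offDiag,
            (if ((p.1 ∉ S ∧ p.2 ∉ S) ∧
                ((∃ j : Fin k, st S (t + 1) Φ (Φ p.1 j).1 = none ∧ ∀ j' : Fin k, j' ≠ j →
                  st S (t + 1) Φ (Φ p.1 j').1 ≠ none ∧ st S (t + 1) Φ (Φ p.1 j').1 ≠ some (Φ p.1 j').2) ∧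
                (∃ j : Fin k, st S (t + 1) Φ (Φ p.2 j).1 = none ∧ ∀ j' : Fin k, j' ≠ j →
                  st S (t + 1) Φ (Φ p.2 j').1 ≠ none ∧ st S (t + 1) Φ (Φ p.2 j').1 ≠ some (Φ p.2 j').2)))
              then (1 : ℝ) else 0)) = (F.offDiag.card : ℝ) := by
      rw [sum_boole]
      congr 1
      congr 1
      ext p
      simp only [mem_filter, mem_offDiag, mem_univ, true_and, hF]
      tauto
    rw [hoff, offDiag_card]
    have hle : F.card ≤ F.card * F.card := Nat.le_mul_self _
    push_cast [Nat.cast_sub hle]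
    ring
  simp_rw [hsq]
  rw [sum_add_distrib, mul_add]
  refine add_le_add (mul_le_mul_of_nonneg_left (hN (t + 1) S) (by positivity)) ?_
  -- the pair terms
  rw [sum_comm, mul_sum]
  have hpair : ∀ p ∈ (univ : Finset (Fin m)).offDiag,
      (Fintype.card (Fin k → Fin n × Bool) : ℝ) ^ 2 * ∑ Φ : Fin m → Fin k → Fin n × Bool,
        (if ((p.1 ∉ S ∧ p.2 ∉ S) ∧
            ((∃ j : Fin k, st S (t + 1) Φ (Φ p.1 j).1 = none ∧ ∀ j' : Fin k, j' ≠ j →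
              st S (t + 1) Φ (Φ p.1 j').1 ≠ none ∧ st S (t + 1) Φ (Φ p.1 j').1 ≠ some (Φ p.1 j').2) ∧
            (∃ j : Fin k, st S (t + 1) Φ (Φ p.2 j).1 = none ∧ ∀ j' : Fin k, j' ≠ j →
              st S (t + 1) Φ (Φ p.2 j').1 ≠ none ∧ st S (t + 1) Φ (Φ p.2 j').1 ≠ some (Φ p.2 j').2)))
          then (1 : ℝ) else 0)
        ≤ (((k * k - k : ℕ) : ℝ) * (2 * M * (n : ℝ) ^ (k - 1))) ^ 2 *
          ((W ^ 2 + 2 * W * a + q) * Fintype.card (Fin m → Fin k → Fin n × Bool)) := by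
    intro p hp
    rw [mem_offDiag] at hp
    by_cases hpS : p.1 ∉ S ∧ p.2 ∉ S
    · have h1 := sissU_sum_pair_indicator_le st dm h0 hstep hdm S t p.1 p.2 hpS.1 hpS.2 hp.2.2
      have hsimp : ∀ Φ : Fin m → Fin k → Fin n × Bool,
          (if ((p.1 ∉ S ∧ p.2 ∉ S) ∧
              ((∃ j : Fin k, st S (t + 1) Φ (Φ p.1 j).1 = none ∧ ∀ j' : Fin k, j' ≠ j →
                st S (t + 1) Φ (Φ p.1 j').1 ≠ none ∧ st S (t + 1) Φ (Φ p.1 j').1 ≠ some (Φ p.1 j').2) ∧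
              (∃ j : Fin k, st S (t + 1) Φ (Φ p.2 j).1 = none ∧ ∀ j' : Fin k, j' ≠ j →
                st S (t + 1) Φ (Φ p.2 j').1 ≠ none ∧ st S (t + 1) Φ (Φ p.2 j').1 ≠ some (Φ p.2 j').2)))
            then (1 : ℝ) else 0)
            = (if (∃ j : Fin k, st S (t + 1) Φ (Φ p.1 j).1 = none ∧ ∀ j' : Fin k, j' ≠ j →
                st S (t + 1) Φ (Φ p.1 j').1 ≠ none ∧ st S (t + 1) Φ (Φ p.1 j').1 ≠ some (Φ p.1 j').2) ∧
              (∃ j : Fin k, st S (t + 1) Φ (Φ p.2 j).1 = none ∧ ∀ j' : Fin k, j' ≠ j →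
                st S (t + 1) Φ (Φ p.2 j').1 ≠ none ∧ st S (t + 1) Φ (Φ p.2 j').1 ≠ some (Φ p.2 j').2)
            then (1 : ℝ) else 0) := by
        intro Φ
        simp only [hpS, not_false_eq_true, true_and]
      simp_rw [hsimp]
      rw [sq, mul_assoc]
      refine h1.trans ?_
      -- `cnt ≤ K·New`, then the expanded square
      have hcnt : ∀ Φ : Fin m → Fin k → Fin n × Bool,
          (((k * k - k) * ((2 * ((univ : Finset (Fin n)).filter fun w =>
              st (insert p.2 (insert p.1 S)) (t + 1) Φ w = none).card) *
            ((univ : Finset (Fin n)).filter fun w => st (insert p.2 (insert p.1 S)) t Φ w = none ∧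
              st (insert p.2 (insert p.1 S)) (t + 1) Φ w ≠ none).card *
            ((univ : Finset (Fin n)).filter fun w =>
              st (insert p.2 (insert p.1 S)) (t + 1) Φ w ≠ none).card ^ (k - 2)) : ℕ) : ℝ)
          ≤ (((k * k - k : ℕ) : ℝ) * (2 * M * (n : ℝ) ^ (k - 1))) *
            ((((univ : Finset (Fin n)).filter fun w => st (insert p.2 (insert p.1 S)) t Φ w = none ∧
              st (insert p.2 (insert p.1 S)) (t + 1) Φ w ≠ none).card : ℕ) : ℝ) := by
        intro Φ
        set U := ((univ : Finset (Fin n)).filter fun w => st (insert p.2 (insert p.1 S)) (t + 1) Φ w = none).card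
        set Nw := ((univ : Finset (Fin n)).filter fun w => st (insert p.2 (insert p.1 S)) t Φ w = none ∧
          st (insert p.2 (insert p.1 S)) (t + 1) Φ w ≠ none).card
        set St := ((univ : Finset (Fin n)).filter fun w => st (insert p.2 (insert p.1 S)) (t + 1) Φ w ≠ none).card
          with hSt
        have hUS : U + St = n := by
          have := card_filter_add_card_filter_not (s := (univ : Finset (Fin n)))
            (fun w => st (insert p.2 (insert p.1 S)) (t + 1) Φ w = none)
          rw [card_univ, Fintype.card_fin] at this
          convert this using 2
        have hM' := hM U St hUS
        have hK : (0 : ℝ) ≤ ((k * k - k : ℕ) : ℝ) := Nat.cast_nonneg _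
        push_cast
        calc ((k * k - k : ℕ) : ℝ) * (2 * (U : ℝ) * Nw * (St : ℝ) ^ (k - 2))
            = ((k * k - k : ℕ) : ℝ) * (2 * ((U : ℝ) * (St : ℝ) ^ (k - 2)) * Nw) := by ring
          _ ≤ ((k * k - k : ℕ) : ℝ) * (2 * (M * (n : ℝ) ^ (k - 1)) * Nw) := by
              refine mul_le_mul_of_nonneg_left ?_ hK
              exact mul_le_mul_of_nonneg_right (mul_le_mul_of_nonneg_left hM' (by norm_num)) (Nat.cast_nonneg _)
          _ = _ := by ring
      have hK0 : 0 ≤ ((k * k - k : ℕ) : ℝ) * (2 * M * (n : ℝ) ^ (k - 1)) := by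
        have hMn : 0 ≤ M * (n : ℝ) ^ (k - 1) := by
          have := hM 0 n (Nat.zero_add n)
          simp only [Nat.cast_zero, zero_mul] at this
          exact this
        exact mul_nonneg (Nat.cast_nonneg _) (by rw [mul_assoc]; exact mul_nonneg (by norm_num) hMn)
      have hsq2 : ∀ Φ : Fin m → Fin k → Fin n × Bool,
          (((k * k - k) * ((2 * ((univ : Finset (Fin n)).filter fun w =>
              st (insert p.2 (insert p.1 S)) (t + 1) Φ w = none).card) *
            ((univ : Finset (Fin n)).filter fun w => st (insert p.2 (insert p.1 S)) t Φ w = none ∧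
              st (insert p.2 (insert p.1 S)) (t + 1) Φ w ≠ none).card *
            ((univ : Finset (Fin n)).filter fun w =>
              st (insert p.2 (insert p.1 S)) (t + 1) Φ w ≠ none).card ^ (k - 2)) : ℕ) : ℝ) ^ 2
          ≤ (((k * k - k : ℕ) : ℝ) * (2 * M * (n : ℝ) ^ (k - 1))) ^ 2 *
            ((((univ : Finset (Fin n)).filter fun w => st (insert p.2 (insert p.1 S)) t Φ w = none ∧
              st (insert p.2 (insert p.1 S)) (t + 1) Φ w ≠ none).card : ℕ) : ℝ) ^ 2 := by
        intro Φ
        rw [← mul_pow]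
        exact pow_le_pow_left₀ (Nat.cast_nonneg _) (hcnt Φ) 2
      refine (sum_le_sum fun Φ _ => hsq2 Φ).trans ?_
      rw [← mul_sum]
      refine mul_le_mul_of_nonneg_left ?_ (by positivity)
      exact sissU_sum_new_sq_le st dm hstep W hW a hN q t (insert p.2 (insert p.1 S))
        (hq (insert p.2 (insert p.1 S)))
    · have hzero : ∀ Φ : Fin m → Fin k → Fin n × Bool,
          (if ((p.1 ∉ S ∧ p.2 ∉ S) ∧
              ((∃ j : Fin k, st S (t + 1) Φ (Φ p.1 j).1 = none ∧ ∀ j' : Fin k, j' ≠ j →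
                st S (t + 1) Φ (Φ p.1 j').1 ≠ none ∧ st S (t + 1) Φ (Φ p.1 j').1 ≠ some (Φ p.1 j').2) ∧
              (∃ j : Fin k, st S (t + 1) Φ (Φ p.2 j).1 = none ∧ ∀ j' : Fin k, j' ≠ j →
                st S (t + 1) Φ (Φ p.2 j').1 ≠ none ∧ st S (t + 1) Φ (Φ p.2 j').1 ≠ some (Φ p.2 j').2)))
            then (1 : ℝ) else 0) = 0 := by
        intro Φ
        rw [if_neg (fun h => hpS h.1)]
      simp only [hzero, sum_const_zero, mul_zero]
      have hnew := sissU_sum_new_sq_le st dm hstep W hW a hN q t S (hq S)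
      have h0' : 0 ≤ (W ^ 2 + 2 * W * a + q) * Fintype.card (Fin m → Fin k → Fin n × Bool) :=
        le_trans (sum_nonneg fun Φ _ => by positivity) hnew
      exact mul_nonneg (sq_nonneg _) h0'
  refine (sum_le_sum hpair).trans ?_
  rw [sum_const, nsmul_eq_mul, offDiag_card, card_univ, Fintype.card_fin]
  have hmm : ((m * m - m : ℕ) : ℝ) ≤ (m : ℝ) * m := by
    have := Nat.sub_le (m * m) m
    exact_mod_cast this
  have hnew0 : 0 ≤ (W ^ 2 + 2 * W * a + q) * Fintype.card (Fin m → Fin k → Fin n × Bool) := by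
    have := sissU_sum_new_sq_le st dm hstep W hW a hN q t S (hq S)
    exact le_trans (sum_nonneg fun Φ _ => by positivity) this
  calc ((m * m - m : ℕ) : ℝ) * ((((k * k - k : ℕ) : ℝ) * (2 * M * (n : ℝ) ^ (k - 1))) ^ 2 *
        ((W ^ 2 + 2 * W * a + q) * Fintype.card (Fin m → Fin k → Fin n × Bool)))
      ≤ ((m : ℝ) * m) * ((((k * k - k : ℕ) : ℝ) * (2 * M * (n : ℝ) ^ (k - 1))) ^ 2 *
        ((W ^ 2 + 2 * W * a + q) * Fintype.card (Fin m → Fin k → Fin n × Bool))) :=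
        mul_le_mul_of_nonneg_right hmm (mul_nonneg (sq_nonneg _) hnew0)
    _ = _ := by ring

end SecondMoment

section Main

variable {m k n : ℕ} {R : ℕ}

/-- **Second moment of the number of unit clauses, uniformly in the muting.** Let `k ≥ 2`, `n ≥ 1`
and let `q ≥ 0` satisfy the fixed-point inequality `#C²·a + m²·K²·(W² + 2Wa + q) ≤ q·#C²`
(`K = (k²-k)·2M·n^{k-1}`; solvable iff `mK < #C`, the unit-clause threshold).  Then for every round `t`
and muted set `S`: `Σ_Φ (N^S_t)² ≤ q·#Ω`. -/
theorem sissU_sum_unit_sq_le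
    (st : Finset (Fin m) → ℕ → (Fin m → Fin k → Fin n × Bool) → Fin n → Option Bool)
    (dm : Finset (Fin m) → ℕ → (Fin m → Fin k → Fin n × Bool) → Fin n → Bool)
    (h0 : ∀ (S : Finset (Fin m)) (Φ : Fin m → Fin k → Fin n × Bool) (v : Fin n), st S 0 Φ v = none)
    (hstep : ∀ (S : Finset (Fin m)) (t : ℕ) (Φ : Fin m → Fin k → Fin n × Bool) (v : Fin n),
      st S (t + 1) Φ v =
        if st S t Φ v = none then
          (if ∃ i : Fin m, i ∉ S ∧ ∃ j : Fin k, (Φ i j).1 = v ∧ ∀ j' : Fin k, j' ≠ j →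
              st S t Φ (Φ i j').1 ≠ none ∧ st S t Φ (Φ i j').1 ≠ some (Φ i j').2
            then some (dm S t Φ v)
            else if (v : ℕ) * R / n = t then some true else none)
        else st S t Φ v)
    (hdm : ∀ (S : Finset (Fin m)) (t : ℕ) (Φ : Fin m → Fin k → Fin n × Bool) (v : Fin n) (i : Fin m)
      (j : Fin k), i ∉ S → (Φ i j).1 = v → st S t Φ v = none →
      (∀ j' : Fin k, j' ≠ j → st S t Φ (Φ i j').1 ≠ none ∧ st S t Φ (Φ i j').1 ≠ some (Φ i j').2) →
      (∀ i' : Fin m, i' ∉ S → (∃ j₁ : Fin k, (Φ i' j₁).1 = v ∧ ∀ j' : Fin k, j' ≠ j₁ →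
        st S t Φ (Φ i' j').1 ≠ none ∧ st S t Φ (Φ i' j').1 ≠ some (Φ i' j').2) → i ≤ i') →
      dm S t Φ v = (Φ i j).2)
    (M : ℝ) (hM : ∀ u s : ℕ, u + s = n → (u : ℝ) * (s : ℝ) ^ (k - 2) ≤ M * (n : ℝ) ^ (k - 1))
    (W : ℝ) (hW : ∀ t : ℕ, ((((univ : Finset (Fin n)).filter fun v : Fin n => (v : ℕ) * R / n = t).card : ℕ) : ℝ) ≤ W)
    (a : ℝ)
    (hN : ∀ (t : ℕ) (S : Finset (Fin m)), ∑ Φ : Fin m → Fin k → Fin n × Bool,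
      (((univ : Finset (Fin m)).filter fun i => i ∉ S ∧ ∃ j : Fin k, st S t Φ (Φ i j).1 = none ∧
        ∀ j' : Fin k, j' ≠ j → st S t Φ (Φ i j').1 ≠ none ∧ st S t Φ (Φ i j').1 ≠ some (Φ i j').2).card : ℝ)
      ≤ a * Fintype.card (Fin m → Fin k → Fin n × Bool))
    (hk : 2 ≤ k) (hn : 1 ≤ n) (q : ℝ) (hq0 : 0 ≤ q)
    (hqfix : (Fintype.card (Fin k → Fin n × Bool) : ℝ) ^ 2 * a +
      ((m : ℝ) * m) * (((k * k - k : ℕ) : ℝ) * (2 * M * (n : ℝ) ^ (k - 1))) ^ 2 * (W ^ 2 + 2 * W * a + q)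
        ≤ q * (Fintype.card (Fin k → Fin n × Bool) : ℝ) ^ 2) :
    ∀ (t : ℕ) (S : Finset (Fin m)), ∑ Φ : Fin m → Fin k → Fin n × Bool,
      (((univ : Finset (Fin m)).filter fun i => i ∉ S ∧ ∃ j : Fin k, st S t Φ (Φ i j).1 = none ∧
        ∀ j' : Fin k, j' ≠ j → st S t Φ (Φ i j').1 ≠ none ∧ st S t Φ (Φ i j').1 ≠ some (Φ i j').2).card : ℝ) ^ 2
      ≤ q * Fintype.card (Fin m → Fin k → Fin n × Bool) := by
  intro t
  induction t with
  | zero =>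
    intro S
    have hzero : ∀ Φ : Fin m → Fin k → Fin n × Bool,
        (((univ : Finset (Fin m)).filter fun i => i ∉ S ∧ ∃ j : Fin k, st S 0 Φ (Φ i j).1 = none ∧
          ∀ j' : Fin k, j' ≠ j → st S 0 Φ (Φ i j').1 ≠ none ∧ st S 0 Φ (Φ i j').1 ≠ some (Φ i j').2).card : ℝ) ^ 2
          = 0 := by
      intro Φ
      rw [sq_eq_zero_iff, Nat.cast_eq_zero, card_eq_zero, filter_eq_empty_iff]
      intro i _ hi
      obtain ⟨j, hj, hrest⟩ := hi.2
      exact sissU_not_unit_zero st h0 hk S Φ i (Φ i j).1 ⟨j, rfl, hj, hrest⟩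
    simp only [hzero, sum_const_zero]
    exact mul_nonneg hq0 (Nat.cast_nonneg _)
  | succ t ih =>
    intro S
    haveI : Nonempty (Fin k → Fin n × Bool) := ⟨fun _ => (⟨0, hn⟩, true)⟩
    have hC : (0 : ℝ) < (Fintype.card (Fin k → Fin n × Bool) : ℝ) ^ 2 := by
      have : (0 : ℝ) < Fintype.card (Fin k → Fin n × Bool) := by exact_mod_cast Fintype.card_pos
      positivity
    have hrec := sissU_sum_unit_sq_succ_le st dm h0 hstep hdm M hM W hW a hN q t ih S
    refine le_of_mul_le_mul_left (hrec.trans ?_) hC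
    have h2 := mul_le_mul_of_nonneg_right hqfix (Nat.cast_nonneg (Fintype.card (Fin m → Fin k → Fin n × Bool)))
    calc (Fintype.card (Fin k → Fin n × Bool) : ℝ) ^ 2 * (a * Fintype.card (Fin m → Fin k → Fin n × Bool)) +
          ((m : ℝ) * m) * (((k * k - k : ℕ) : ℝ) * (2 * M * (n : ℝ) ^ (k - 1))) ^ 2 *
            ((W ^ 2 + 2 * W * a + q) * Fintype.card (Fin m → Fin k → Fin n × Bool))
        = ((Fintype.card (Fin k → Fin n × Bool) : ℝ) ^ 2 * a +
            ((m : ℝ) * m) * (((k * k - k : ℕ) : ℝ) * (2 * M * (n : ℝ) ^ (k - 1))) ^ 2 * (W ^ 2 + 2 * W * a + q)) *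
            Fintype.card (Fin m → Fin k → Fin n × Bool) := by ring
      _ ≤ q * (Fintype.card (Fin k → Fin n × Bool) : ℝ) ^ 2 * Fintype.card (Fin m → Fin k → Fin n × Bool) := h2
      _ = _ := by ring

end Main


end Summit.PneNP.PneNP.Theorems
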